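import Mathlib.Analysis.Convex.SimplicialComplex.Basic
import Mathlib.Analysis.Convex.Topology
import Mathlib.Analysis.Normed.Module.FiniteDimension
import Mathlib.Geometry.Manifold.HasGroupoid
import Mathlib.Geometry.Manifold.IsManifold.Basic
import Mathlib.Geometry.Manifold.Instances.Real
import Mathlib.Analysis.InnerProductSpace.PiL2
import Mathlib.LinearAlgebra.AffineSpace.AffineMap
import Mathlib.Analysis.Calculus.ContDiff.Defs
import Mathlib.Analysis.Calculus.FDeriv.Basic
import Mathlib.Topology.LocallyFinite
import HarnessLib

-- provenance: harness21/H21/H21/Prelude/FourManL/PLManifold.lean @ 5e204f8 (interim HEAD d8f2665); M5 mechanical rewrite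
/-!
# Piecewise-linear manifolds (trunk G24 `FourManL`, prelude; notion `pl_manifold`)

This file sets up PL (piecewise-linear) manifolds in the `ChartedSpace`/`StructureGroupoid`
framework of Mathlib, and the Whitehead compatibility relation between a PL structure and a
smooth structure on the same topological manifold.

## Contents

* `Literature.IsPLOn n m f u`: the map `f : ℝⁿ → ℝᵐ` is piecewise linear on `u ⊆ ℝⁿ`: every point of `u`
  has a neighbourhood inside `u` which is the underlying space of a *finite* (geometric) simplicial
  complex on each of whose simplices `f` agrees with an affine map
  (Rourke–Sanderson, *Introduction to piecewise-linear topology* (1972), Ch. 1 and 2.14;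
  Hudson, *Piecewise linear topology* (1969), III.1).
* `Literature.plPregroupoid n`, `Literature.plGroupoid n`: the PL pregroupoid/groupoid on `ℝⁿ`, exactly parallel
  to Mathlib's `contDiffPregroupoid`/`contDiffGroupoid`.
* `Literature.IsPLManifold n M`: a charted space modelled on `ℝⁿ` whose atlas lies in `plGroupoid n`
  (mirrors `IsManifold I n M extends HasGroupoid M (contDiffGroupoid n I)`);
  `Literature.PLHomeomorph n M M' := Structomorph (plGroupoid n) M M'`.
* `Literature.IsPDOn n f u`: `f` is piecewise differentiable of maximal rank on `u` (smooth immersion on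
  each simplex of a local finite triangulation), and `Literature.IsWhiteheadCompatible n M cPL cDIFF`:
  the identity `M_PL → M_DIFF` is piecewise differentiable in charts, i.e. the PL structure is a
  smooth (Whitehead) triangulation of the smooth structure (J.H.C. Whitehead, *On C¹-complexes*,
  Ann. of Math. 41 (1940); Munkres, *Elementary differential topology* (1966), §8 and Thm 10.6).
* Theorems (proofs `sorry`, cited): existence and uniqueness of the Whitehead PL structure of a
  smooth manifold.

## Mathlib

Mathlib has `StructureGroupoid`, `Pregroupoid`, `HasGroupoid`, `Structomorph`,
`hasGroupoid_model_space` and geometric simplicial complexes `Geometry.SimplicialComplex`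
(with `space`, `faces`), all of which we use; it has no PL maps or PL manifolds
(`rg PiecewiseLinear` has no hits).

## Design

* `IsPLOn` is phrased locally ("locally a finite simplicial complex inside `u` on whose simplices
  `f` is affine") so that the `locality` and `congr` axioms of a `Pregroupoid` are provable
  outright; `comp` (common subdivisions, R–S 2.14), `mono` (subdivision to shrink the support)
  and `isPLOn_affineMap` (a simplex neighbourhood of every point) are classical and stated as
  named facts; `comp` and `isPLOn_affineMap` are threaded as the explicit hypotheses `hcomp haff`
  of `plPregroupoid`, `plGroupoid`, `IsPLManifold`, `PLHomeomorph` and the Whitehead statements.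
* PL manifolds are a `Prop`-valued class over a `ChartedSpace (EuclideanSpace ℝ (Fin n)) M`
  argument, so that "two PL structures on the same topological manifold" is expressed by two
  `ChartedSpace` structures, as in Wave0 `S33` and Mathlib's exotic-structure statements.
-/

open scoped Manifold ContDiff Topology
open Set Function

noncomputable section

namespace Literature.Topology.FourManifolds

local notation "𝔼 " n:arg => EuclideanSpace ℝ (Fin n)

/-! ### PL maps between Euclidean spaces -/

section PLMaps

variable (n m : ℕ)

/-- `IsPLOn n m f u`: the map `f : ℝⁿ → ℝᵐ` is *piecewise linear on* `u`: every `a ∈ u` admits a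
finite geometric simplicial complex `K` in `ℝⁿ` whose underlying space `K.space` is a
neighbourhood of `a` contained in `u`, such that on (the closed simplex spanned by) each face of
`K` the map `f` agrees with an affine map `ℝⁿ →ᵃ[ℝ] ℝᵐ`.
Rourke–Sanderson (1972), Ch. 1 (PL maps) and 2.14; Hudson (1969), III.1. [cite: RourkeSanderson1972] -/
def IsPLOn (f : 𝔼 n → 𝔼 m) (u : Set (𝔼 n)) : Prop :=
  ∀ a ∈ u, ∃ K : Geometry.SimplicialComplex ℝ (𝔼 n), K.faces.Finite ∧ K.space ∈ 𝓝 a ∧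
    K.space ⊆ u ∧ ∀ s ∈ K.faces, ∃ g : 𝔼 n →ᵃ[ℝ] 𝔼 m, EqOn f g (convexHull ℝ (s : Set (𝔼 n)))

variable {n m}

/-- PL-ness is a local property by construction: if every `a ∈ u` lies in some `v ⊆ u` on which
`f` is PL, then `f` is PL on `u`. (Internal API; Rourke–Sanderson (1972), Ch. 1.) [cite: RourkeSanderson1972] -/
theorem IsPLOn.of_forall_exists {f : 𝔼 n → 𝔼 m} {u : Set (𝔼 n)}
    (h : ∀ a ∈ u, ∃ v ⊆ u, a ∈ v ∧ IsPLOn n m f v) : IsPLOn n m f u := by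
  intro a ha
  obtain ⟨v, hvu, hav, hv⟩ := h a ha
  obtain ⟨K, hfin, hnhds, hsub, hK⟩ := hv a hav
  exact ⟨K, hfin, hnhds, hsub.trans hvu, hK⟩

/-- Restriction of a PL map to an *open* subset is PL: if `f` is PL on `u` and `v ⊆ u` is open,
then `f` is PL on `v` (subdivide the local complex so that a subcomplex neighbourhood of `a` lies
in `v`). Rourke–Sanderson (1972), 2.11–2.12 (subdivision). [cite: RourkeSanderson1972] -/
def IsPLOn.mono : Prop :=
  ∀ {f : 𝔼 n → 𝔼 m} {u v : Set (𝔼 n)} (hf : IsPLOn n m f u) (hv : IsOpen v) (hvu : v ⊆ u),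
    IsPLOn n m f v

/-- The composite of PL maps is PL (on the natural domain `u ∩ f ⁻¹' v`): take a common
subdivision of the local complex for `f` and the pull-back of the local complex for `g`.
Rourke–Sanderson (1972), 2.14; Hudson (1969), Lemma 1.9. [cite: RourkeSanderson1972] -/
def IsPLOn.comp : Prop :=
  ∀ {f g : 𝔼 n → 𝔼 n} {u v : Set (𝔼 n)} (hf : IsPLOn n n f u) (hg : IsPLOn n n g v) (hu : IsOpen u) (hv : IsOpen v) (huv : IsOpen (u ∩ f ⁻¹' v)),
    IsPLOn n n (g ∘ f) (u ∩ f ⁻¹' v)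

/-- An affine map `ℝⁿ →ᵃ[ℝ] ℝᵐ` is PL on all of `ℝⁿ` (every point of `ℝⁿ` lies in the interior
of an `n`-simplex, which with its faces is a finite simplicial complex).
Rourke–Sanderson (1972), Ch. 1, Example. [cite: RourkeSanderson1972] -/
def isPLOn_affineMap : Prop :=
  ∀ (g : 𝔼 n →ᵃ[ℝ] 𝔼 m),
    IsPLOn n m g univ

variable (n) in
/-- The identity of `ℝⁿ` is PL, given the fact `isPLOn_affineMap` as the hypothesis `haff`.
Rourke–Sanderson (1972), Ch. 1. [cite: RourkeSanderson1972] -/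
theorem isPLOn_id (haff : isPLOn_affineMap (n := n) (m := n)) : IsPLOn n n id univ :=
  haff (AffineMap.id ℝ (𝔼 n))

/-- Locality of PL-ness: if every point of the open set `u` has an open neighbourhood `v` with `f`
PL on `u ∩ v`, then `f` is PL on `u`. Immediate from the local form of the definition.
Rourke–Sanderson (1972), Ch. 1. [cite: RourkeSanderson1972] -/
theorem IsPLOn.locality {f : 𝔼 n → 𝔼 m} {u : Set (𝔼 n)} (_hu : IsOpen u)
    (h : ∀ x ∈ u, ∃ v, IsOpen v ∧ x ∈ v ∧ IsPLOn n m f (u ∩ v)) : IsPLOn n m f u := by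
  refine IsPLOn.of_forall_exists fun a ha => ?_
  obtain ⟨v, -, hav, hv⟩ := h a ha
  exact ⟨u ∩ v, inter_subset_left, ⟨ha, hav⟩, hv⟩

/-- PL-ness only depends on the values of the map on the set: if `g = f` on `u` and `f` is PL
on `u` then so is `g`. Rourke–Sanderson (1972), Ch. 1. [cite: RourkeSanderson1972] -/
theorem IsPLOn.congr {f g : 𝔼 n → 𝔼 m} {u : Set (𝔼 n)} (_hu : IsOpen u)
    (h : ∀ x ∈ u, g x = f x) (hf : IsPLOn n m f u) : IsPLOn n m g u := by
  intro a ha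
  obtain ⟨K, hfin, hnhds, hsub, hK⟩ := hf a ha
  refine ⟨K, hfin, hnhds, hsub, fun s hs => ?_⟩
  obtain ⟨g', hg'⟩ := hK s hs
  refine ⟨g', fun x hx => ?_⟩
  rw [h x (hsub (Geometry.SimplicialComplex.convexHull_subset_space hs hx))]
  exact hg' hx

/-- A PL map is continuous on its domain: locally it is a map which is affine (hence continuous)
on each of finitely many closed simplices covering a neighbourhood.
Rourke–Sanderson (1972), Ch. 1. [cite: RourkeSanderson1972] -/
theorem IsPLOn.continuousOn {f : 𝔼 n → 𝔼 m} {u : Set (𝔼 n)} (hf : IsPLOn n m f u) :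
    ContinuousOn f u := by
  intro a ha
  obtain ⟨K, hfin, hnhds, -, hK⟩ := hf a ha
  have hcont : ContinuousOn f K.space := by
    have : K.space = ⋃ s : K.faces, convexHull ℝ ((s : Finset (𝔼 n)) : Set (𝔼 n)) := by
      simp only [Geometry.SimplicialComplex.space, biUnion_eq_iUnion]
    rw [this]
    haveI : Finite K.faces := hfin.to_subtype
    refine (locallyFinite_of_finite _).continuousOn_iUnion (fun s => ?_) (fun s => ?_)
    · exact (s.1.finite_toSet).isClosed_convexHull ℝ
    · obtain ⟨g, hg⟩ := hK s.1 s.2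
      have hgc : Continuous g := AffineMap.continuous_of_finiteDimensional (𝕜 := ℝ) g
      exact hgc.continuousOn.congr hg
  exact (hcont.continuousAt hnhds).continuousWithinAt

end PLMaps

/-! ### The PL groupoid and PL manifolds -/

section PLGroupoid

variable (n : ℕ)

-- Standing hypotheses of the PL groupoid: the two closure facts of PL maps that are not proved in
-- this file, composition (`IsPLOn.comp`) and PL-ness of affine maps (`isPLOn_affineMap`, for the
-- identity). They are threaded as explicit arguments `hcomp haff` of everything built on the
-- groupoid.
variable (hcomp : IsPLOn.comp (n := n)) (haff : isPLOn_affineMap (n := n) (m := n))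

/-- The pregroupoid of PL self-maps of `ℝⁿ`: `property f u := IsPLOn n n f u`. Its groupoid
`plGroupoid n` consists of the PL homeomorphisms between open subsets of `ℝⁿ` with PL inverse.
Parallel to Mathlib's `contDiffPregroupoid`. Rourke–Sanderson (1972), Ch. 1 (PL structures via
PL atlases); Hudson (1969), III.1.
Takes the facts `IsPLOn.comp` (`hcomp`) and `isPLOn_affineMap` (`haff`, for `isPLOn_id`) as
explicit hypotheses; `IsPLOn.locality`, `IsPLOn.congr` are proved. [cite: RourkeSanderson1972] -/
def plPregroupoid : Pregroupoid (𝔼 n) where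
  property f u := IsPLOn n n f u
  comp hf hg hu hv huv := hcomp hf hg hu hv huv
  id_mem := isPLOn_id n haff
  locality hu h := IsPLOn.locality hu h
  congr hu h hf := hf.congr hu h

/-- The groupoid of PL local homeomorphisms of `ℝⁿ` (PL with PL inverse), the structure groupoid
of PL `n`-manifolds (hypotheses `hcomp haff` as in `plPregroupoid`). Rourke–Sanderson (1972),
Ch. 1. [cite: RourkeSanderson1972] -/
def plGroupoid : StructureGroupoid (𝔼 n) :=
  (plPregroupoid n hcomp haff).groupoid

/-- Membership in the PL groupoid does not mention the hypotheses: a local homeomorphism of `ℝⁿ`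
is in `plGroupoid n` iff it is PL on its source and its inverse is PL on its target
(Mathlib's `mem_groupoid_of_pregroupoid`). Rourke–Sanderson (1972), Ch. 1. [folklore] -/
theorem mem_plGroupoid_iff {e : OpenPartialHomeomorph (𝔼 n) (𝔼 n)} :
    e ∈ plGroupoid n hcomp haff ↔ IsPLOn n n e e.source ∧ IsPLOn n n e.symm e.target :=
  mem_groupoid_of_pregroupoid

/-- A *PL `n`-manifold*: a charted space modelled on `ℝⁿ` all of whose transition maps are PL
homeomorphisms, i.e. whose atlas belongs to `plGroupoid n` (hypotheses `hcomp haff` as in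
`plPregroupoid`; by `mem_plGroupoid_iff` the condition on the atlas does not depend on them).
Mirrors Mathlib's `IsManifold I n M extends HasGroupoid M (contDiffGroupoid n I)`.
Rourke–Sanderson (1972), Ch. 1; Hudson (1969), III.1. [cite: RourkeSanderson1972] -/
class IsPLManifold (M : Type*) [TopologicalSpace M] [ChartedSpace (𝔼 n) M] : Prop
    extends HasGroupoid M (plGroupoid n hcomp haff)

/-- `ℝⁿ` with its one-chart atlas is a PL manifold (any groupoid is compatible with the model
space, `hasGroupoid_model_space`). Rourke–Sanderson (1972), Ch. 1. [cite: RourkeSanderson1972] -/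
instance instIsPLManifoldEuclideanSpace : IsPLManifold n hcomp haff (𝔼 n) :=
  { hasGroupoid_model_space _ _ with }

/-- The PL structure on a PL manifold is in particular a `HasGroupoid` structure for
`plGroupoid n` (projection of the class). Rourke–Sanderson (1972), Ch. 1. [cite: RourkeSanderson1972] -/
theorem IsPLManifold.compatible_of_mem_atlas {M : Type*} [TopologicalSpace M]
    [ChartedSpace (𝔼 n) M] [IsPLManifold n hcomp haff M] {e e' : OpenPartialHomeomorph M (𝔼 n)}
    (he : e ∈ atlas (𝔼 n) M) (he' : e' ∈ atlas (𝔼 n) M) :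
    e.symm ≫ₕ e' ∈ plGroupoid n hcomp haff :=
  HasGroupoid.compatible he he'

/-- PL homeomorphisms between PL `n`-manifolds: homeomorphisms which read as elements of
`plGroupoid n` in all charts, i.e. Mathlib's `Structomorph (plGroupoid n) M M'` (hypotheses
`hcomp haff` as in `plPregroupoid`). Rourke–Sanderson (1972), Ch. 1. [cite: RourkeSanderson1972] -/
abbrev PLHomeomorph (M M' : Type*) [TopologicalSpace M] [ChartedSpace (𝔼 n) M]
    [TopologicalSpace M'] [ChartedSpace (𝔼 n) M'] : Type _ :=
  Structomorph (plGroupoid n hcomp haff) M M'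

end PLGroupoid

/-! ### Whitehead compatibility of PL and smooth structures -/

section Whitehead

variable (n : ℕ)
variable (hcomp : IsPLOn.comp (n := n)) (haff : isPLOn_affineMap (n := n) (m := n))

/-- `IsPDOn n f u`: the map `f : ℝⁿ → ℝⁿ` is *piecewise differentiable of maximal rank* on `u`:
every `a ∈ u` admits a finite simplicial complex `K` with `K.space` a neighbourhood of `a` inside
`u` such that on each closed simplex of `K` the map `f` agrees with a `C^∞` map `g : ℝⁿ → ℝⁿ`
whose derivative is injective at every point of the simplex. This is the chart-level condition
for a triangulation to be a *smooth (`C^∞`) triangulation* in the sense of Whitehead.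
J.H.C. Whitehead, *On C¹-complexes*, Ann. of Math. 41 (1940), §1; Munkres (1966), Def. 8.3. [cite: Munkres1966] -/
def IsPDOn (f : 𝔼 n → 𝔼 n) (u : Set (𝔼 n)) : Prop :=
  ∀ a ∈ u, ∃ K : Geometry.SimplicialComplex ℝ (𝔼 n), K.faces.Finite ∧ K.space ∈ 𝓝 a ∧
    K.space ⊆ u ∧ ∀ s ∈ K.faces, ∃ g : 𝔼 n → 𝔼 n, ContDiff ℝ ∞ g ∧
      EqOn f g (convexHull ℝ (s : Set (𝔼 n))) ∧
      ∀ x ∈ convexHull ℝ (s : Set (𝔼 n)), Injective (fderiv ℝ g x)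

/-- *Whitehead compatibility* of a PL atlas `cPL` and a smooth atlas `cDIFF` on the same
topological manifold `M`: for every PL chart `e` and every smooth chart `e'`, the transition map
`e' ∘ e.symm` is piecewise differentiable of maximal rank on its domain. Equivalently, the
identity `M_PL → M_DIFF` is a piecewise-differentiable homeomorphism, i.e. `cPL` is (the PL
structure of) a smooth triangulation of `(M, cDIFF)`.
Whitehead (1940); Munkres (1966), §8 and Thm 10.6. [cite: Whitehead1940] -/
def IsWhiteheadCompatible (M : Type*) [TopologicalSpace M] (cPL cDIFF : ChartedSpace (𝔼 n) M) :
    Prop :=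
  ∀ e ∈ @atlas (𝔼 n) _ M _ cPL, ∀ e' ∈ @atlas (𝔼 n) _ M _ cDIFF,
    IsPDOn n (e' ∘ e.symm) (e.symm.trans e').source

universe u

/-- **Whitehead's triangulation theorem (existence).** Every smooth `n`-manifold `M` (Hausdorff,
second countable, `C^∞` atlas `cDIFF`) admits a PL structure `cPL` on the same topological space
which is Whitehead-compatible with `cDIFF`, i.e. a smooth triangulation (PL structures relative
to the hypotheses `hcomp haff` of `plGroupoid`).
J.H.C. Whitehead, *On C¹-complexes*, Ann. of Math. 41 (1940), Thm 7; Munkres (1966), Thm 10.6. [cite: Munkres1966] -/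
def exists_isPLManifold_isWhiteheadCompatible : Prop :=
  ∀ (M : Type u) [TopologicalSpace M] [T2Space M] [SecondCountableTopology M] [cDIFF : ChartedSpace (𝔼 n) M] [IsManifold (𝓡 n) ∞ M],
    ∃ cPL : ChartedSpace (𝔼 n) M,
      @IsPLManifold n hcomp haff M _ cPL ∧ IsWhiteheadCompatible n M cPL cDIFF

/-- **Whitehead's triangulation theorem (uniqueness).** Two PL structures `c₁`, `c₂` on the
topological space underlying a smooth `n`-manifold `(M, cDIFF)` which are both
Whitehead-compatible with `cDIFF` are PL homeomorphic (there is a `Structomorph` for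
`plGroupoid n` from `(M, c₁)` to `(M, c₂)`; PL structures relative to the hypotheses `hcomp haff`).
J.H.C. Whitehead, *On C¹-complexes*, Ann. of Math. 41 (1940), Thm 8; Munkres (1966), Thm 10.5. [cite: Munkres1966] -/
def nonempty_plHomeomorph_of_isWhiteheadCompatible : Prop :=
  ∀ (M : Type u) [TopologicalSpace M] [T2Space M] [SecondCountableTopology M] [cDIFF : ChartedSpace (𝔼 n) M] [IsManifold (𝓡 n) ∞ M] (c₁ c₂ : ChartedSpace (𝔼 n) M) (_h₁ : @IsPLManifold n hcomp haff M _ c₁) (_h₂ : @IsPLManifold n hcomp haff M _ c₂) (_hc₁ : IsWhiteheadCompatible n M c₁ cDIFF) (_hc₂ : IsWhiteheadCompatible n M c₂ cDIFF),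
    Nonempty (@Structomorph (𝔼 n) _ (plGroupoid n hcomp haff) M M _ _ c₁ c₂)

end Whitehead

end Literature.Topology.FourManifolds
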